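import Mathlib
import Summits.ValiantsHypothesis.ValiantsHypothesis.Theorems.NewtonUnitEquationsDissociatedUniformTotalsLawUnion
import Literature.Computability.AlgebraicComplexity.NewtonPolygonTauBounds
import HarnessLib

/-!
# Crux `NewtonUnitEquations.DissociatedUniform` (stmt-ValiantsHypothesis-5905): the `n = 3` totals law — the FIRST BOUNDS FOR
# ARBITRARY LABELLINGS on the union / few-valued stratum, from the Eisenbrand–Pach–Rothvoß–Sopher theorem

Companion of `…DissociatedUniformTotalsLawUnion` (the union-of-fibres sub-law `UnionTotalsLaw C : ∑_s #vert conv U_s(Z) ≤ C|G|²`,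
OPEN, located at `C = 2`; `U_s(Z) = ⋃_{z∈Z} P_{s-z} ⊆ A + B`).  Every union-stratum theorem of the programme so far
(`…TotalsLawUnimodal`, `…UnimodalClasses`, `…LeftTurning`, `…Modality`, `…UnionCosets`, `…UnionCoSmall`) assumes a STRUCTURED
labelling (convexly ordered pairs, cosets, co-small position sets); for ARBITRARY `a b : G → ℝ²` and arbitrary `Z` the tree had
only the trivial envelope `#vert conv U_s(Z) ≤ min(|Z|·|G|, |G|²)` and `unionTotal ≤ |Z|·|G|² ≤ |G|³`.

Observation typed here (memo `Cruxes/DissociatedUniform/NOTES-t1.md` D5 / `NOTES-d1g3.md` L6 knew it on paper: "EPRS caps ANY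
convex subset of `A+B` at `O(q^{4/3})`; a two-valued `c` reduces the law to this"): the hull vertices of ANY subset `U ⊆ A + B`
form a convexly independent subset of the Minkowski sum `A + B`, so the tree's effective Eisenbrand–Pach–Rothvoß–Sopher bound
`KPTT.EPRS.card_le_of_convexIndependent_subset_add` (`#S ≤ 16(#P^{2/3}#Q^{2/3} + #P + #Q)`, Literature, by name) gives, for
EVERY finite abelian `G`, ALL `a b`, EVERY `Z` and every class `s` (`q = |G|`):
* `ncard_extremePoints_le_eprs` — `U ⊆ P + Q` ⇒ `#vert conv U ≤ 16(#P^{2/3}#Q^{2/3} + #P + #Q)` (EPRS for hulls of subsets);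
* **`unionVert_le_eprs`** — `#vert conv U_s(Z) ≤ 16(q^{4/3} + 2q)` POINTWISE (`≤ 48·q^{4/3}`, `unionVert_le_eprs'`; cube form in `ℕ`:
  `unionVert_pow_three_le`), the first sub-trivial pointwise bound for arbitrary labellings (trivial: `|Z|·q`);
* **`unionTotal_le_eprs`** — `unionTotal a b Z ≤ 16 q (q^{4/3} + 2q) = O(q^{7/3})`: the union totals law holds for arbitrary
  labellings with exponent `7/3` in place of the conjectured `2` (trivial: `3`);
* **`classVert_le_eprs_of_card_image` / `totalVert_le_eprs_of_card_image`** — an `m`-valued third curve gives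
  `V_s ≤ 16 m (q^{4/3} + 2q)` and `T(a,b,c) ≤ 16 m q (q^{4/3} + 2q)` for ALL `a b` (level-set decomposition
  `classVert_le_sum_unionVert` of `…TotalsLawUnion`); `totalVert_le_eprs_of_twoValued`: the two-valued stratum of the `n = 3` law
  holds with `T ≤ 32 q (q^{4/3} + 2q) = O(q^{7/3})` for arbitrary labellings.
What this does NOT do: for an injective third curve (`m = q`) the bound is `O(q^{10/3})`, worse than trivial — per class EPRS is
void because ONE class can hold `q²/4` vertices (parabola gadget, NOTES-d1g3 L2); the `n = 3` law `TotalsLawThree`, the union law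
`UnionTotalsLaw 2` and `TwoValuedTotalsLaw` remain OPEN with their conjectured exponent `2`.  Nothing here bears on VP ≠ VNP.
[cite: EisenbrandEtAl2008, Theorem 1] is used BY NAME through the Literature file `NewtonPolygonTauBounds` (discharged there).
-/

set_option linter.dupNamespace false -- `ValiantsHypothesis.ValiantsHypothesis` (summit = problem) in every name

open scoped BigOperators Pointwise

namespace Summit.ValiantsHypothesis.ValiantsHypothesis.Theorems.NewtonUnitEquationsDissociatedUniform

namespace TotalsLaw

open Literature.Computability.AlgebraicComplexity

variable {G : Type*} [AddCommGroup G] [Fintype G]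

/-! ### EPRS for the hull vertices of an arbitrary subset of a sum of two finite planar sets -/

omit [AddCommGroup G] [Fintype G] in
/-- **Eisenbrand–Pach–Rothvoß–Sopher for hulls of subsets.**  If `U ⊆ P + Q` for finite planar `P, Q`, then the hull of `U` has at
most `16(#P^{2/3}·#Q^{2/3} + #P + #Q)` vertices: the extreme points of `conv U` lie in `U ⊆ P + Q` and are convexly independent, so
the tree's effective EPRS bound `KPTT.EPRS.card_le_of_convexIndependent_subset_add` applies. [cite: EisenbrandEtAl2008, Theorem 1] -/
theorem ncard_extremePoints_le_eprs (P Q : Finset (Fin 2 → ℝ)) {U : Set (Fin 2 → ℝ)}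
    (hU : U ⊆ ((P + Q : Finset (Fin 2 → ℝ)) : Set (Fin 2 → ℝ))) :
    ((Set.extremePoints ℝ (convexHull ℝ U)).ncard : ℝ) ≤
      16 * ((P.card : ℝ) ^ (2 / 3 : ℝ) * (Q.card : ℝ) ^ (2 / 3 : ℝ) + P.card + Q.card) := by
  classical
  set V : Set (Fin 2 → ℝ) := Set.extremePoints ℝ (convexHull ℝ U) with hV
  have hVU : V ⊆ U := extremePoints_convexHull_subset
  have hUfin : U.Finite := (Finset.finite_toSet _).subset hU
  have hVfin : V.Finite := hUfin.subset hVU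
  set S : Finset (Fin 2 → ℝ) := hVfin.toFinset with hS
  have hScoe : (S : Set (Fin 2 → ℝ)) = V := Set.Finite.coe_toFinset _
  have hSsub : S ⊆ P + Q := by
    intro x hx
    have hxV : x ∈ V := (Set.Finite.mem_toFinset _).1 hx
    exact Finset.mem_coe.1 (hU (hVU hxV))
  have hVci : ConvexIndependent ℝ (fun p : V => (p : Fin 2 → ℝ)) :=
    (convex_convexHull ℝ U).convexIndependent_extremePoints
  have hci : ConvexIndependent ℝ (Subtype.val : ↥(S : Set (Fin 2 → ℝ)) → (Fin 2 → ℝ)) :=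
    hVci.mono hScoe.subset
  have hcard : V.ncard = S.card := by rw [← hScoe, Set.ncard_coe_finset]
  rw [hcard]
  exact KPTT.EPRS.card_le_of_convexIndependent_subset_add P Q S hSsub hci

/-- `q^{2/3} · q^{2/3} = q^{4/3}` for the (positive) order of the label group. [folklore] -/
theorem card_rpow_two_thirds_mul_self :
    (Fintype.card G : ℝ) ^ (2 / 3 : ℝ) * (Fintype.card G : ℝ) ^ (2 / 3 : ℝ) = (Fintype.card G : ℝ) ^ (4 / 3 : ℝ) := by
  have hq : (0 : ℝ) < Fintype.card G := by exact_mod_cast Fintype.card_pos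
  rw [← Real.rpow_add hq]
  norm_num

/-! ### Pointwise: every fibre union has `O(q^{4/3})` hull vertices, for arbitrary labellings -/

/-- **Pointwise EPRS bound for fibre unions (arbitrary labellings).**  For every finite abelian `G`, all `a b : G → ℝ²`, every
position set `Z` and every class `s`: `#vert conv U_s(Z) ≤ 16·(|G|^{4/3} + 2|G|)`.  (`U_s(Z) ⊆ A + B` with `#A, #B ≤ |G|`.)
[cite: EisenbrandEtAl2008, Theorem 1] -/
theorem unionVert_le_eprs (a b : G → (Fin 2 → ℝ)) (Z : Set G) (s : G) :
    (unionVert a b Z s : ℝ) ≤ 16 * ((Fintype.card G : ℝ) ^ (4 / 3 : ℝ) + 2 * Fintype.card G) := by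
  classical
  set P : Finset (Fin 2 → ℝ) := Finset.univ.image a with hP
  set Q : Finset (Fin 2 → ℝ) := Finset.univ.image b with hQ
  have hU : unionPts a b Z s ⊆ ((P + Q : Finset (Fin 2 → ℝ)) : Set (Fin 2 → ℝ)) := by
    intro p hp
    obtain ⟨x, y, -, rfl⟩ := mem_unionPts.1 hp
    rw [Finset.coe_add]
    refine Set.add_mem_add ?_ ?_
    · exact Finset.mem_coe.2 (Finset.mem_image.2 ⟨x, Finset.mem_univ _, rfl⟩)
    · exact Finset.mem_coe.2 (Finset.mem_image.2 ⟨y, Finset.mem_univ _, rfl⟩)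
  have h := ncard_extremePoints_le_eprs P Q hU
  have hPq : (P.card : ℝ) ≤ Fintype.card G := by
    exact_mod_cast Finset.card_image_le.trans (Finset.card_univ (α := G)).le
  have hQq : (Q.card : ℝ) ≤ Fintype.card G := by
    exact_mod_cast Finset.card_image_le.trans (Finset.card_univ (α := G)).le
  unfold unionVert
  calc ((Set.extremePoints ℝ (convexHull ℝ (unionPts a b Z s))).ncard : ℝ)
      ≤ 16 * ((P.card : ℝ) ^ (2 / 3 : ℝ) * (Q.card : ℝ) ^ (2 / 3 : ℝ) + P.card + Q.card) := h
    _ ≤ 16 * ((Fintype.card G : ℝ) ^ (2 / 3 : ℝ) * (Fintype.card G : ℝ) ^ (2 / 3 : ℝ)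
          + Fintype.card G + Fintype.card G) := by
        gcongr
    _ = 16 * ((Fintype.card G : ℝ) ^ (4 / 3 : ℝ) + 2 * Fintype.card G) := by
        rw [card_rpow_two_thirds_mul_self]; ring

/-- `q ≤ q^{4/3}` for the order of the label group. [folklore] -/
theorem card_le_card_rpow_four_thirds : (Fintype.card G : ℝ) ≤ (Fintype.card G : ℝ) ^ (4 / 3 : ℝ) := by
  have hq : (1 : ℝ) ≤ Fintype.card G := by exact_mod_cast Fintype.card_pos
  calc (Fintype.card G : ℝ) = (Fintype.card G : ℝ) ^ (1 : ℝ) := (Real.rpow_one _).symm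
    _ ≤ (Fintype.card G : ℝ) ^ (4 / 3 : ℝ) := Real.rpow_le_rpow_of_exponent_le hq (by norm_num)

/-- Pointwise EPRS bound, one-term form: `#vert conv U_s(Z) ≤ 48·|G|^{4/3}`. [cite: EisenbrandEtAl2008, Theorem 1] -/
theorem unionVert_le_eprs' (a b : G → (Fin 2 → ℝ)) (Z : Set G) (s : G) :
    (unionVert a b Z s : ℝ) ≤ 48 * (Fintype.card G : ℝ) ^ (4 / 3 : ℝ) := by
  have h := unionVert_le_eprs a b Z s
  have h2 := card_le_card_rpow_four_thirds (G := G)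
  linarith

/-- Pointwise EPRS bound, cube form in `ℕ`: `(#vert conv U_s(Z))³ ≤ 48³·|G|⁴` (`48³ = 110592`). [cite: EisenbrandEtAl2008, Theorem 1] -/
theorem unionVert_pow_three_le (a b : G → (Fin 2 → ℝ)) (Z : Set G) (s : G) :
    unionVert a b Z s ^ 3 ≤ 110592 * Fintype.card G ^ 4 := by
  have h := unionVert_le_eprs' a b Z s
  have hq0 : (0 : ℝ) ≤ Fintype.card G := by positivity
  have hV0 : (0 : ℝ) ≤ unionVert a b Z s := by positivity
  have hpow : ((Fintype.card G : ℝ) ^ (4 / 3 : ℝ)) ^ (3 : ℕ) = (Fintype.card G : ℝ) ^ (4 : ℕ) := by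
    rw [← Real.rpow_natCast, ← Real.rpow_mul hq0]
    norm_num
  have h3 : ((unionVert a b Z s : ℕ) : ℝ) ^ 3 ≤ (48 * (Fintype.card G : ℝ) ^ (4 / 3 : ℝ)) ^ 3 :=
    pow_le_pow_left₀ hV0 h 3
  rw [mul_pow, hpow] at h3
  have h4 : ((unionVert a b Z s ^ 3 : ℕ) : ℝ) ≤ ((110592 * Fintype.card G ^ 4 : ℕ) : ℝ) := by
    push_cast
    linarith
  exact_mod_cast h4

/-! ### Totals: the union totals law with exponent `7/3`, for arbitrary labellings -/

/-- **`unionTotal a b Z ≤ 16·|G|·(|G|^{4/3} + 2|G|) = O(|G|^{7/3})`** for every finite abelian `G`, all `a b` and every `Z`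
(conjectured: `≤ 2|G|²`; trivial: `|Z|·|G|²`). [cite: EisenbrandEtAl2008, Theorem 1] -/
theorem unionTotal_le_eprs (a b : G → (Fin 2 → ℝ)) (Z : Set G) :
    (unionTotal a b Z : ℝ) ≤
      16 * Fintype.card G * ((Fintype.card G : ℝ) ^ (4 / 3 : ℝ) + 2 * Fintype.card G) := by
  unfold unionTotal
  push_cast
  calc ∑ s, (unionVert a b Z s : ℝ)
      ≤ ∑ _s : G, 16 * ((Fintype.card G : ℝ) ^ (4 / 3 : ℝ) + 2 * Fintype.card G) :=
        Finset.sum_le_sum fun s _ => unionVert_le_eprs a b Z s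
    _ = 16 * Fintype.card G * ((Fintype.card G : ℝ) ^ (4 / 3 : ℝ) + 2 * Fintype.card G) := by
        rw [Finset.sum_const, Finset.card_univ, nsmul_eq_mul]; ring

/-- One-term form: `unionTotal a b Z ≤ 48·|G|^{7/3}`. [cite: EisenbrandEtAl2008, Theorem 1] -/
theorem unionTotal_le_eprs' (a b : G → (Fin 2 → ℝ)) (Z : Set G) :
    (unionTotal a b Z : ℝ) ≤ 48 * (Fintype.card G : ℝ) ^ (7 / 3 : ℝ) := by
  have hq : (0 : ℝ) < Fintype.card G := by exact_mod_cast Fintype.card_pos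
  have h73 : (Fintype.card G : ℝ) ^ (7 / 3 : ℝ) = Fintype.card G * (Fintype.card G : ℝ) ^ (4 / 3 : ℝ) := by
    rw [show (7 / 3 : ℝ) = 1 + 4 / 3 by norm_num, Real.rpow_add hq, Real.rpow_one]
  unfold unionTotal
  push_cast
  calc ∑ s, (unionVert a b Z s : ℝ) ≤ ∑ _s : G, 48 * (Fintype.card G : ℝ) ^ (4 / 3 : ℝ) :=
        Finset.sum_le_sum fun s _ => unionVert_le_eprs' a b Z s
    _ = 48 * (Fintype.card G : ℝ) ^ (7 / 3 : ℝ) := by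
        rw [Finset.sum_const, Finset.card_univ, nsmul_eq_mul, h73]; ring

/-! ### The `n = 3` law on the `m`-valued stratum with exponent `7/3`, for arbitrary labellings -/

/-- **`m`-valued third curve, pointwise.**  If `c` takes at most `m` values then every class has
`V_s ≤ 16·m·(|G|^{4/3} + 2|G|)` hull vertices, for ALL `a b` (level sets: `V_s ≤ ∑_v #vert conv U_s(c⁻¹ v)`).
[cite: EisenbrandEtAl2008, Theorem 1] -/
theorem classVert_le_eprs_of_card_image (a b c : G → (Fin 2 → ℝ)) (s : G) [DecidableEq (Fin 2 → ℝ)] {m : ℕ}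
    (hm : (Finset.univ.image c).card ≤ m) :
    (classVert a b c s : ℝ) ≤ 16 * m * ((Fintype.card G : ℝ) ^ (4 / 3 : ℝ) + 2 * Fintype.card G) := by
  have h := classVert_le_sum_unionVert a b c s
  have hK : (0 : ℝ) ≤ 16 * ((Fintype.card G : ℝ) ^ (4 / 3 : ℝ) + 2 * Fintype.card G) := by positivity
  have hm' : ((Finset.univ.image c).card : ℝ) ≤ m := by exact_mod_cast hm
  calc (classVert a b c s : ℝ)
      ≤ ((∑ v ∈ Finset.univ.image c, unionVert a b (c ⁻¹' {v}) s : ℕ) : ℝ) := by exact_mod_cast h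
    _ = ∑ v ∈ Finset.univ.image c, (unionVert a b (c ⁻¹' {v}) s : ℝ) := by push_cast; rfl
    _ ≤ ∑ _v ∈ Finset.univ.image c, 16 * ((Fintype.card G : ℝ) ^ (4 / 3 : ℝ) + 2 * Fintype.card G) :=
        Finset.sum_le_sum fun v _ => unionVert_le_eprs a b _ s
    _ = (Finset.univ.image c).card * (16 * ((Fintype.card G : ℝ) ^ (4 / 3 : ℝ) + 2 * Fintype.card G)) := by
        rw [Finset.sum_const, nsmul_eq_mul]
    _ ≤ m * (16 * ((Fintype.card G : ℝ) ^ (4 / 3 : ℝ) + 2 * Fintype.card G)) :=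
        mul_le_mul_of_nonneg_right hm' hK
    _ = 16 * m * ((Fintype.card G : ℝ) ^ (4 / 3 : ℝ) + 2 * Fintype.card G) := by ring

/-- **`m`-valued third curve, totals: `T(a,b,c) ≤ 16·m·|G|·(|G|^{4/3} + 2|G|) = O(m·|G|^{7/3})`** for ALL `a b`
(conjectured `O(|G|²)`; informative for `m = o(q^{2/3})`, void for injective `c`). [cite: EisenbrandEtAl2008, Theorem 1] -/
theorem totalVert_le_eprs_of_card_image (a b c : G → (Fin 2 → ℝ)) [DecidableEq (Fin 2 → ℝ)] {m : ℕ}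
    (hm : (Finset.univ.image c).card ≤ m) :
    (totalVert a b c : ℝ) ≤
      16 * m * Fintype.card G * ((Fintype.card G : ℝ) ^ (4 / 3 : ℝ) + 2 * Fintype.card G) := by
  unfold totalVert
  push_cast
  calc ∑ s, (classVert a b c s : ℝ)
      ≤ ∑ _s : G, 16 * m * ((Fintype.card G : ℝ) ^ (4 / 3 : ℝ) + 2 * Fintype.card G) :=
        Finset.sum_le_sum fun s _ => classVert_le_eprs_of_card_image a b c s hm
    _ = 16 * m * Fintype.card G * ((Fintype.card G : ℝ) ^ (4 / 3 : ℝ) + 2 * Fintype.card G) := by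
        rw [Finset.sum_const, Finset.card_univ, nsmul_eq_mul]; ring

/-- **The two-valued stratum of the `n = 3` law with exponent `7/3`, arbitrary labellings:** if `c z ∈ {v₀, v₁}` for every `z`
then `T(a,b,c) ≤ 32·|G|·(|G|^{4/3} + 2|G|)`.  (`TwoValuedTotalsLaw C` asks for `C|G|²`; OPEN.) [cite: EisenbrandEtAl2008, Theorem 1] -/
theorem totalVert_le_eprs_of_twoValued (a b c : G → (Fin 2 → ℝ)) (v₀ v₁ : Fin 2 → ℝ)
    (hc : ∀ z, c z = v₀ ∨ c z = v₁) :
    (totalVert a b c : ℝ) ≤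
      32 * Fintype.card G * ((Fintype.card G : ℝ) ^ (4 / 3 : ℝ) + 2 * Fintype.card G) := by
  classical
  have hm : (Finset.univ.image c).card ≤ 2 := by
    have hsub : Finset.univ.image c ⊆ ({v₀, v₁} : Finset (Fin 2 → ℝ)) := by
      intro v hv
      obtain ⟨z, -, rfl⟩ := Finset.mem_image.1 hv
      rcases hc z with hz | hz <;> simp [hz]
    exact (Finset.card_le_card hsub).trans Finset.card_le_two
  have h := totalVert_le_eprs_of_card_image a b c hm
  calc (totalVert a b c : ℝ) ≤ 16 * (2 : ℕ) * Fintype.card G * ((Fintype.card G : ℝ) ^ (4 / 3 : ℝ) + 2 * Fintype.card G) := h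
    _ = 32 * Fintype.card G * ((Fintype.card G : ℝ) ^ (4 / 3 : ℝ) + 2 * Fintype.card G) := by push_cast; ring

end TotalsLaw

end Summit.ValiantsHypothesis.ValiantsHypothesis.Theorems.NewtonUnitEquationsDissociatedUniform
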